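import Literature.IUT.HodgeArakelov.ThetaEnvDataRecordAutSaturated
import Literature.IUT.HodgeArakelov.PointedInversionFunctorial

/-!
# [IUTchII] Prop 2.2 (i) / 3.1 (i): abc-iut-w6-d002's SATURATED index set consists of genuine representatives of `[ι]`

Proof-only corollary (abc-iut cell, WAVE-4 seat abc-iut-w4-d010 gen 6; cone of [IUTchIII] Cor. 3.12; DAG nodes
**IUTchII:Prop2.2(i)** (ι-clause) and **IUTchII:Prop3.4(i)** (index set of the multiradiality statement of record
`EtaleLevels.prop34i_multiradiallyDefined_saturated`, p432926); plan/GAP-LEDGER.md rows G-w5d169-1 / D-G-w5d169-1).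
S. Mochizuki, *Inter-universal Teichmüller theory II*, kurims manuscript (Dec. 2020), Prop. 2.2 (i) p. 66, Prop. 3.1 (i)
p. 87 («[ι ranges] over the inversion automorphisms of Proposition 2.2, (i)»), Rmk. 1.4.1 (ii) p. 28 (claim key
`Mochizuki2012`, DISPUTED, D-0012). No definitions; nothing of abc-iut-w6-d002 / w5-d169 / w5-d072 restated.

WHAT IS PROVED: by the OUTER functoriality of the pointed inversion (`PointedInversionFunctorial.lean`:
`ρ_α ∘ ρ_{ι₀} ∘ ρ_α⁻¹ = h1LimConj δ ∘ ρ_{ι₀}`, `δ ∈ Δ`), abc-iut-w6-d002's `Aut_top(Π^tp_X̲̲)`-saturated index set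
`EtaleLevels.saturatedOrbit ι₀ = {ρ_α ∘ ρ_{ι₀} ∘ ρ_α⁻¹}` is contained in the `Δ`-OUTER CLASS
`{h1LimConj δ ∘ ρ_{ι₀} : δ ∈ Δ}` of the inversion action — every saturated index is the action `ρ_{conj_δ ∘ ι₀}` of a
`Δ`-conjugate of `ι₀`, i.e. of a genuine representative of the outer automorphism `ι` of Rmk. 1.4.1 (ii) («an inversion
automorphism of Proposition 2.2, (i)»). Inputs: the pointed-inversion binders in abc-iut-w5-d072's shapes (`hover`,
`δ/hδ/hαα`, `γ/hγ/hαγ`, `huniq`) and either the `Δ`-stability of every `α` (`hΔ`) or F-0620 BY NAME + the identification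
`hEnv` (`…_of_cor218_i`). Nothing here takes a side on [IUTchIII] Cor. 3.12; typed ≠ proved.
-/

noncomputable section

namespace Literature.IUT.HodgeArakelov

namespace EtaleThetaDataOfSetting

open Literature.AnabelianGeometry.EtaleTheta Literature.AnabelianGeometry.SemiGraphs CohomologySystemOfContH1
open Literature.AnabelianGeometry.SemiGraphs.Thm68Sub (conjCME conjCME_apply)

variable {p : ℕ} [Fact p.Prime] {D : Literature.AnabelianGeometry.EtaleTheta.ThetaSetting p}
  {E : D.EtaleThetaData} {l : ℕ} (C : E.DoubleUnderline l)
  {S : ThetaSetting.{0}} (Env : EnvOfGroup S (Pi C)) (α₀ : (Pi C) ≃ₜ* (Pi C))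
  (hover : ∀ x : Pi C, Env.recon.projG (Env.isoX (α₀ x)) = Env.recon.projG (Env.isoX x))
  (δ : Pi C) (hδ : Env.recon.projG (Env.isoX δ) = 1) (hαα : ∀ x : Pi C, α₀ (α₀ x) = δ * x * δ⁻¹)
  (γ : Pi C) (hγ : C.toLZ γ = Multiplicative.ofAdd 1) (hαγ : C.toLZ (α₀ γ) = Multiplicative.ofAdd (-1))
  (huniq : ∀ κ : (Pi C) ≃ₜ* (Pi C),
    (∀ x : Pi C, Env.recon.projG (Env.isoX (κ x)) = Env.recon.projG (Env.isoX x)) →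
    (∃ δ' : Pi C, Env.recon.projG (Env.isoX δ') = 1 ∧ ∀ x : Pi C, κ (κ x) = δ' * x * δ'⁻¹) →
    (¬ ∃ δ' : Pi C, Env.recon.projG (Env.isoX δ') = 1 ∧ ∀ x : Pi C, κ x = δ' * x * δ'⁻¹) →
      ∃ δ' : Pi C, Env.recon.projG (Env.isoX δ') = 1 ∧ ∀ x : Pi C, κ x = δ' * α₀ x * δ'⁻¹)
  (hq : Topology.IsQuotientMap D.toTheta) {N : ℕ+} (μ : D.CyclotomeMod l N)

include hover hδ hαα hγ hαγ huniq in
/-- **`I_sat(ι₀) ⊆` the `Δ`-outer class of `ρ_{ι₀}`**: every member `ρ_α ∘ ρ_{ι₀} ∘ ρ_α⁻¹` of abc-iut-w6-d002's saturated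
index set is `h1LimConj δ' ∘ ρ_{ι₀}` for some `δ' ∈ Δ` — given the `Δ`-stability of every `α ∈ Aut_top(Π^tp_X̲̲)` (`hΔ`).
[claim: Mochizuki2012, status: disputed] (IUTchII §3 Prop 3.1 (i), kurims p.87) -/
theorem saturatedOrbit_subset_deltaClass_of_pair [(PiYdd C).Normal] (hC : D.Compat) (hS : D.Sec2Hyps)
    (h15 : D.Prop15iii E hC) (L : C.CuspLabels) (R : RigidData.{0} N l) (hR : R = C.rigidData μ hC hS h15 L)
    (h218i : R.Cor218_i)
    (hΔ : ∀ (α : (Pi C) ≃ₜ* (Pi C)) (x : Pi C),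
      Env.recon.projG (Env.isoX (α x)) = 1 ↔ Env.recon.projG (Env.isoX x) = 1) :
    EtaleLevels.saturatedOrbit C hC hS h15 L hq μ R hR h218i α₀ ⊆
      {e | ∃ δ' : Pi C, Env.recon.projG (Env.isoX δ') = 1 ∧ ∀ x,
        e x = h1LimConj (phi C) (D.lDeltaTheta l) (PiYdd C) δ' (autActOfCor218i C hq μ hC hS h15 L R hR h218i α₀ x)} := by
  rintro e ⟨α, hα⟩
  obtain ⟨δ', hδ', h⟩ := exists_autActOfCor218i_conj_eq_h1LimConj_of_pair C Env α₀ hover δ hδ hαα γ hγ hαγ huniq hq μ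
    hC hS h15 L R hR h218i α (hΔ α)
  exact ⟨δ', hδ', fun x => by rw [hα x, h x]⟩

include hover hδ hαα hγ hαγ huniq in
/-- **`I_sat(ι₀) ⊆` the `Δ`-outer class of `ρ_{ι₀}`, modulo F-0620 BY NAME and ONE identification datum** `hEnv`
(«`Ker(Π ≅ Π_X(M^Θ(Π)) ↠ G) = Δ^tp_X ∩ Π^tp_X̲̲ = Ker(aug)`»): the `Δ`-stability of every `α` is the `Δ_X`-clause of
[EtTh] Cor. 2.18 (i) (`projG_isoX_eq_one_iff_of_cor218_i`). [claim: Mochizuki2012, status: disputed]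
(IUTchII §3 Prop 3.1 (i), kurims p.87) -/
theorem saturatedOrbit_subset_deltaClass_of_cor218_i [(PiYdd C).Normal] (hC : D.Compat) (hS : D.Sec2Hyps)
    (h15 : D.Prop15iii E hC) (L : C.CuspLabels) (R : RigidData.{0} N l) (hR : R = C.rigidData μ hC hS h15 L)
    (h218i : R.Cor218_i)
    (hEnv : ∀ x : Pi C, Env.recon.projG (Env.isoX x) = 1 ↔ x ∈ (C.rigidData μ hC hS h15 L).aug.ker) :
    EtaleLevels.saturatedOrbit C hC hS h15 L hq μ R hR h218i α₀ ⊆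
      {e | ∃ δ' : Pi C, Env.recon.projG (Env.isoX δ') = 1 ∧ ∀ x,
        e x = h1LimConj (phi C) (D.lDeltaTheta l) (PiYdd C) δ' (autActOfCor218i C hq μ hC hS h15 L R hR h218i α₀ x)} :=
  saturatedOrbit_subset_deltaClass_of_pair C Env α₀ hover δ hδ hαα γ hγ hαγ huniq hq μ hC hS h15 L R hR h218i
    (projG_isoX_eq_one_iff_of_cor218_i C Env μ hC hS h15 L R hR h218i hEnv)

include hover hδ hαα hγ hαγ huniq in
/-- Conversely-shaped bookkeeping: every element of the `Δ`-outer class that IS a transport `ρ_α ∘ ρ_{ι₀} ∘ ρ_α⁻¹` lies in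
`I_sat(ι₀)` by definition; in particular `ρ_{ι₀}` itself (`δ' = 1`, abc-iut-w6-d002's `autActOfCor218i_mem_saturatedOrbit`)
— recorded as the sandwich `inversionOrbit ρ_{ι₀} ⊆ I_sat(ι₀) ⊆ Δ-outer class of ρ_{ι₀}`.
[claim: Mochizuki2012, status: disputed] (IUTchII §3 Prop 3.1 (i), kurims p.87) -/
theorem inversionOrbit_subset_deltaClass_of_pair [(PiYdd C).Normal] (hC : D.Compat) (hS : D.Sec2Hyps)
    (h15 : D.Prop15iii E hC) (L : C.CuspLabels) (R : RigidData.{0} N l) (hR : R = C.rigidData μ hC hS h15 L)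
    (h218i : R.Cor218_i)
    (hΔ : ∀ (α : (Pi C) ≃ₜ* (Pi C)) (x : Pi C),
      Env.recon.projG (Env.isoX (α x)) = 1 ↔ Env.recon.projG (Env.isoX x) = 1) :
    EtaleLevels.inversionOrbit C (autActOfCor218i C hq μ hC hS h15 L R hR h218i α₀) ⊆
      {e | ∃ δ' : Pi C, Env.recon.projG (Env.isoX δ') = 1 ∧ ∀ x,
        e x = h1LimConj (phi C) (D.lDeltaTheta l) (PiYdd C) δ' (autActOfCor218i C hq μ hC hS h15 L R hR h218i α₀ x)} :=
  (EtaleLevels.inversionOrbit_subset_saturatedOrbit C hC hS h15 L hq μ R hR h218i α₀).trans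
    (saturatedOrbit_subset_deltaClass_of_pair C Env α₀ hover δ hδ hαα γ hγ hαγ huniq hq μ hC hS h15 L R hR h218i hΔ)

end EtaleThetaDataOfSetting

/-! ### §2. Independence of the choice of pointed inversion: the `Δ`-outer class is canonical -/

section Uniqueness

universe u

variable {S : ThetaSetting.{u}} {P : TopGroup.{u}} {E : EnvOfGroup S P} {D : EtaleThetaData S P}

/-- **Any two pointed inversions of the same `Π` are `Δ`-conjugate** ([IUTchII] Rmk. 1.4.1 (ii), kurims p. 28
l. 5–9: «the unique order two `Δ^tp_{X̲̲_k}`-outer automorphism of `Π^tp_{X̲̲_k}` over `G_k`»): for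
`ι₀ ι₁ : PointedInversion E D`, `ι₁ = conj_δ ∘ ι₀` with `δ ∈ Δ` — the field `iota_unique` of `ι₀` applied to the fields
of `ι₁`. So every construction indexed by the `Δ`-OUTER CLASS of `ι₀` is independent of the choice of `ι₀`.
(v2, doc-only: quotation made verbatim — referee lane O, PASS O10-1, O10-F1; no declaration changed.)
[claim: Mochizuki2012, status: disputed] (IUTchII §1 Rmk 1.4.1 (ii), kurims p.28) -/
theorem PointedInversion.exists_deltaConj_of_pointedInversion
    (ι₀ ι₁ : PointedInversion E D) :
    ∃ δ : P, E.recon.projG (E.isoX δ) = 1 ∧ ∀ x : P, ι₁.iota x = δ * ι₀.iota x * δ⁻¹ :=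
  ι₀.iota_unique ι₁.iota ι₁.iota_over_G ι₁.iota_sq_inner ι₁.iota_not_inner

end Uniqueness

namespace EtaleThetaDataOfSetting

variable {p : ℕ} [Fact p.Prime] {D : Literature.AnabelianGeometry.EtaleTheta.ThetaSetting p}
  {E : D.EtaleThetaData} {l : ℕ} (C : E.DoubleUnderline l)
  {S : ThetaSetting.{0}} (Env : EnvOfGroup S (Pi C)) (α₀ : (Pi C) ≃ₜ* (Pi C))
  (hover : ∀ x : Pi C, Env.recon.projG (Env.isoX (α₀ x)) = Env.recon.projG (Env.isoX x))
  (δ : Pi C) (hδ : Env.recon.projG (Env.isoX δ) = 1) (hαα : ∀ x : Pi C, α₀ (α₀ x) = δ * x * δ⁻¹)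
  (γ : Pi C) (hγ : C.toLZ γ = Multiplicative.ofAdd 1) (hαγ : C.toLZ (α₀ γ) = Multiplicative.ofAdd (-1))
  (huniq : ∀ κ : (Pi C) ≃ₜ* (Pi C),
    (∀ x : Pi C, Env.recon.projG (Env.isoX (κ x)) = Env.recon.projG (Env.isoX x)) →
    (∃ δ' : Pi C, Env.recon.projG (Env.isoX δ') = 1 ∧ ∀ x : Pi C, κ (κ x) = δ' * x * δ'⁻¹) →
    (¬ ∃ δ' : Pi C, Env.recon.projG (Env.isoX δ') = 1 ∧ ∀ x : Pi C, κ x = δ' * x * δ'⁻¹) →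
      ∃ δ' : Pi C, Env.recon.projG (Env.isoX δ') = 1 ∧ ∀ x : Pi C, κ x = δ' * α₀ x * δ'⁻¹)
  (hq : Topology.IsQuotientMap D.toTheta) {N : ℕ+} (μ : D.CyclotomeMod l N)

open Literature.AnabelianGeometry.EtaleTheta Literature.AnabelianGeometry.SemiGraphs CohomologySystemOfContH1
open Literature.AnabelianGeometry.SemiGraphs.Thm68Sub (conjCME conjCME_apply)

section OuterClass

/-- **Two pointed inversions at the model are `Δ`-conjugate** (binder shapes of `pointedInversionOfPair`): a second automorphism
`α₁` over `G_k` (`hover₁`), of outer order two (`hsq₁`) and reversing the `ℤ`-torsor at the generator `γ` (`hαγ₁`, whence not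
`Δ`-inner) is `conj_{δ'} ∘ α₀`, `δ' ∈ Δ`, by the uniqueness `huniq` of `α₀`. [claim: Mochizuki2012, status: disputed]
(IUTchII §1 Rmk 1.4.1 (ii), kurims p.28) -/
theorem exists_deltaConj_of_pair_of_pair (γ : Pi C) (hγ : C.toLZ γ = Multiplicative.ofAdd 1)
    (huniq : ∀ κ : (Pi C) ≃ₜ* (Pi C),
      (∀ x : Pi C, Env.recon.projG (Env.isoX (κ x)) = Env.recon.projG (Env.isoX x)) →
      (∃ δ' : Pi C, Env.recon.projG (Env.isoX δ') = 1 ∧ ∀ x : Pi C, κ (κ x) = δ' * x * δ'⁻¹) →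
      (¬ ∃ δ' : Pi C, Env.recon.projG (Env.isoX δ') = 1 ∧ ∀ x : Pi C, κ x = δ' * x * δ'⁻¹) →
        ∃ δ' : Pi C, Env.recon.projG (Env.isoX δ') = 1 ∧ ∀ x : Pi C, κ x = δ' * α₀ x * δ'⁻¹) (α₁ : (Pi C) ≃ₜ* (Pi C))
    (hover₁ : ∀ x : Pi C, Env.recon.projG (Env.isoX (α₁ x)) = Env.recon.projG (Env.isoX x))
    (hsq₁ : ∃ δ₁ : Pi C, Env.recon.projG (Env.isoX δ₁) = 1 ∧ ∀ x : Pi C, α₁ (α₁ x) = δ₁ * x * δ₁⁻¹)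
    (hαγ₁ : C.toLZ (α₁ γ) = Multiplicative.ofAdd (-1)) :
    ∃ δ' : Pi C, Env.recon.projG (Env.isoX δ') = 1 ∧ ∀ x : Pi C, α₁ x = δ' * α₀ x * δ'⁻¹ :=
  huniq α₁ hover₁ hsq₁ (not_inner_of_toLZ C α₁ γ hγ hαγ₁ _)

include hγ huniq in
/-- … hence their Π-intrinsic actions differ by an inner one: `ρ_{α₁} = h1LimConj δ' ∘ ρ_{α₀}`, `δ' ∈ Δ`.
[claim: Mochizuki2012, status: disputed] (IUTchII §1 Rmk 1.4.1 (ii), kurims p.28) -/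
theorem exists_autActOfCor218i_eq_h1LimConj_of_pair_of_pair [(PiYdd C).Normal] (hC : D.Compat) (hS : D.Sec2Hyps)
    (h15 : D.Prop15iii E hC) (L : C.CuspLabels) (R : RigidData.{0} N l) (hR : R = C.rigidData μ hC hS h15 L)
    (h218i : R.Cor218_i) (α₁ : (Pi C) ≃ₜ* (Pi C))
    (hover₁ : ∀ x : Pi C, Env.recon.projG (Env.isoX (α₁ x)) = Env.recon.projG (Env.isoX x))
    (hsq₁ : ∃ δ₁ : Pi C, Env.recon.projG (Env.isoX δ₁) = 1 ∧ ∀ x : Pi C, α₁ (α₁ x) = δ₁ * x * δ₁⁻¹)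
    (hαγ₁ : C.toLZ (α₁ γ) = Multiplicative.ofAdd (-1)) :
    ∃ δ' : Pi C, Env.recon.projG (Env.isoX δ') = 1 ∧ ∀ x,
      autActOfCor218i C hq μ hC hS h15 L R hR h218i α₁ x =
        h1LimConj (phi C) (D.lDeltaTheta l) (PiYdd C) δ' (autActOfCor218i C hq μ hC hS h15 L R hR h218i α₀ x) := by
  obtain ⟨δ', hδ', h⟩ := exists_deltaConj_of_pair_of_pair C Env α₀ γ hγ huniq α₁ hover₁ hsq₁ hαγ₁
  refine ⟨δ', hδ', fun x => ?_⟩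
  have hαα' : α₁ = α₀.trans (conjCME δ') :=
    ContinuousMulEquiv.ext fun y => by rw [ContinuousMulEquiv.trans_apply, conjCME_apply, h]
  rw [autActOfCor218i_congr C hq μ hC hS h15 L R hR h218i hαα' x, autActOfCor218i_trans, autActOfCor218i_conjCME]

include hγ huniq in
/-- **The `Δ`-outer class of the inversion action does not depend on the chosen pointed inversion**:
`{h1LimConj δ ∘ ρ_{α₁} : δ ∈ Δ} = {h1LimConj δ ∘ ρ_{α₀} : δ ∈ Δ}`. [claim: Mochizuki2012, status: disputed]
(IUTchII §3 Prop 3.1 (i), kurims p.87) -/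
theorem deltaClass_eq_of_pair_of_pair [(PiYdd C).Normal] (hC : D.Compat) (hS : D.Sec2Hyps)
    (h15 : D.Prop15iii E hC) (L : C.CuspLabels) (R : RigidData.{0} N l) (hR : R = C.rigidData μ hC hS h15 L)
    (h218i : R.Cor218_i) (α₁ : (Pi C) ≃ₜ* (Pi C))
    (hover₁ : ∀ x : Pi C, Env.recon.projG (Env.isoX (α₁ x)) = Env.recon.projG (Env.isoX x))
    (hsq₁ : ∃ δ₁ : Pi C, Env.recon.projG (Env.isoX δ₁) = 1 ∧ ∀ x : Pi C, α₁ (α₁ x) = δ₁ * x * δ₁⁻¹)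
    (hαγ₁ : C.toLZ (α₁ γ) = Multiplicative.ofAdd (-1)) :
    {e : h1Lim (phi C) (D.lDeltaTheta l) (PiYdd C) ⊥ ≃+ h1Lim (phi C) (D.lDeltaTheta l) (PiYdd C) ⊥ |
        ∃ δ' : Pi C, Env.recon.projG (Env.isoX δ') = 1 ∧ ∀ x,
          e x = h1LimConj (phi C) (D.lDeltaTheta l) (PiYdd C) δ' (autActOfCor218i C hq μ hC hS h15 L R hR h218i α₁ x)} =
      {e | ∃ δ' : Pi C, Env.recon.projG (Env.isoX δ') = 1 ∧ ∀ x,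
          e x = h1LimConj (phi C) (D.lDeltaTheta l) (PiYdd C) δ' (autActOfCor218i C hq μ hC hS h15 L R hR h218i α₀ x)} := by
  obtain ⟨d, hd, h⟩ := exists_autActOfCor218i_eq_h1LimConj_of_pair_of_pair C Env α₀ γ hγ huniq hq μ hC hS h15 L R hR
    h218i α₁ hover₁ hsq₁ hαγ₁
  ext e
  constructor
  · rintro ⟨δ₁, hδ₁, he⟩
    refine ⟨δ₁ * d, by rw [map_mul, map_mul, hδ₁, hd, one_mul], fun x => ?_⟩
    rw [he, h, ← h1LimConj_mul_apply]
  · rintro ⟨δ₀, hδ₀, he⟩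
    refine ⟨δ₀ * d⁻¹, by rw [map_mul, map_mul, map_inv, map_inv, hδ₀, hd, inv_one, one_mul], fun x => ?_⟩
    rw [he, h, ← h1LimConj_mul_apply, inv_mul_cancel_right]

include hover hδ hαα hγ hαγ huniq in
/-- **The `Δ`-outer class is stable under the action of EVERY `Δ`-stable `α ∈ Aut_top(Π^tp_X̲̲)`** (conjugation shape of
abc-iut-w6-d002's `conjAct_mem_saturatedOrbit`): `ρ_α ∘ (h1LimConj δ ∘ ρ_{α₀}) ∘ ρ_α⁻¹ = h1LimConj (α δ · δ'') ∘ ρ_{α₀}` — binder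
(P2) automatic for this index set as well. [claim: Mochizuki2012, status: disputed] (IUTchII §2 Prop 2.2 (i), kurims p.66) -/
theorem conjAct_mem_deltaClass_of_pair [(PiYdd C).Normal] (hC : D.Compat) (hS : D.Sec2Hyps)
    (h15 : D.Prop15iii E hC) (L : C.CuspLabels) (R : RigidData.{0} N l) (hR : R = C.rigidData μ hC hS h15 L)
    (h218i : R.Cor218_i) (α : (Pi C) ≃ₜ* (Pi C))
    (hα : ∀ x : Pi C, Env.recon.projG (Env.isoX (α x)) = 1 ↔ Env.recon.projG (Env.isoX x) = 1)
    {e : h1Lim (phi C) (D.lDeltaTheta l) (PiYdd C) ⊥ ≃+ h1Lim (phi C) (D.lDeltaTheta l) (PiYdd C) ⊥}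
    (he : e ∈ {e : h1Lim (phi C) (D.lDeltaTheta l) (PiYdd C) ⊥ ≃+ h1Lim (phi C) (D.lDeltaTheta l) (PiYdd C) ⊥ |
        ∃ δ' : Pi C, Env.recon.projG (Env.isoX δ') = 1 ∧ ∀ x,
          e x = h1LimConj (phi C) (D.lDeltaTheta l) (PiYdd C) δ' (autActOfCor218i C hq μ hC hS h15 L R hR h218i α₀ x)}) :
    (autActOfCor218i C hq μ hC hS h15 L R hR h218i α).symm.trans
        (e.trans (autActOfCor218i C hq μ hC hS h15 L R hR h218i α)) ∈
      {e : h1Lim (phi C) (D.lDeltaTheta l) (PiYdd C) ⊥ ≃+ h1Lim (phi C) (D.lDeltaTheta l) (PiYdd C) ⊥ |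
        ∃ δ' : Pi C, Env.recon.projG (Env.isoX δ') = 1 ∧ ∀ x,
          e x = h1LimConj (phi C) (D.lDeltaTheta l) (PiYdd C) δ' (autActOfCor218i C hq μ hC hS h15 L R hR h218i α₀ x)} := by
  obtain ⟨δ₁, hδ₁, he⟩ := he
  obtain ⟨d, hd, h⟩ := exists_autActOfCor218i_conj_eq_h1LimConj_of_pair C Env α₀ hover δ hδ hαα γ hγ hαγ huniq hq μ hC hS
    h15 L R hR h218i α hα
  refine ⟨α δ₁ * d, by rw [map_mul, map_mul, (hα δ₁).mpr hδ₁, hd, one_mul], fun x => ?_⟩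
  rw [AddEquiv.trans_apply, AddEquiv.trans_apply, he, autActOfCor218i_conj, h, ← h1LimConj_mul_apply]

include hover in
/-- **The `Δ`-outer class is stable under conjugation by `Π^tp_X̲̲`** (shape of abc-iut-w5-d169's `conj_mem_inversionOrbit`):
`Conj_g ∘ (h1LimConj δ ∘ ρ_{α₀}) ∘ Conj_g⁻¹ = h1LimConj (g δ α₀(g)⁻¹) ∘ ρ_{α₀}` with `g δ α₀(g)⁻¹ ∈ Δ` since `α₀` is over `G_k`.
[claim: Mochizuki2012, status: disputed] (IUTchII §2 Prop 2.2 (i), kurims p.66) -/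
theorem conj_mem_deltaClass_of_pair [(PiYdd C).Normal] (hC : D.Compat) (hS : D.Sec2Hyps)
    (h15 : D.Prop15iii E hC) (L : C.CuspLabels) (R : RigidData.{0} N l) (hR : R = C.rigidData μ hC hS h15 L)
    (h218i : R.Cor218_i) (g : Pi C)
    {e : h1Lim (phi C) (D.lDeltaTheta l) (PiYdd C) ⊥ ≃+ h1Lim (phi C) (D.lDeltaTheta l) (PiYdd C) ⊥}
    (he : e ∈ {e : h1Lim (phi C) (D.lDeltaTheta l) (PiYdd C) ⊥ ≃+ h1Lim (phi C) (D.lDeltaTheta l) (PiYdd C) ⊥ |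
        ∃ δ' : Pi C, Env.recon.projG (Env.isoX δ') = 1 ∧ ∀ x,
          e x = h1LimConj (phi C) (D.lDeltaTheta l) (PiYdd C) δ' (autActOfCor218i C hq μ hC hS h15 L R hR h218i α₀ x)}) :
    ((h1LimConjEquiv (phi C) (D.lDeltaTheta l) (PiYdd C) g⁻¹).trans
        (e.trans (h1LimConjEquiv (phi C) (D.lDeltaTheta l) (PiYdd C) g))) ∈
      {e : h1Lim (phi C) (D.lDeltaTheta l) (PiYdd C) ⊥ ≃+ h1Lim (phi C) (D.lDeltaTheta l) (PiYdd C) ⊥ |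
        ∃ δ' : Pi C, Env.recon.projG (Env.isoX δ') = 1 ∧ ∀ x,
          e x = h1LimConj (phi C) (D.lDeltaTheta l) (PiYdd C) δ' (autActOfCor218i C hq μ hC hS h15 L R hR h218i α₀ x)} := by
  obtain ⟨δ₁, hδ₁, he⟩ := he
  refine ⟨g * δ₁ * α₀ g⁻¹, ?_, fun x => ?_⟩
  · rw [map_mul, map_mul, map_mul, map_mul, hδ₁, mul_one, hover, map_inv, map_inv, mul_inv_cancel]
  · rw [AddEquiv.trans_apply, AddEquiv.trans_apply, h1LimConjEquiv_apply, h1LimConjEquiv_apply, he,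
      autActOfCor218i_conj, ← h1LimConj_mul_apply, ← h1LimConj_mul_apply]

include hover hδ hαα hγ hαγ huniq in
/-- **The saturated orbit of ANY other pointed inversion `α₁` lies in the `Δ`-outer class of `ρ_{α₀}`**: `I_sat(α₁) ⊆
{h1LimConj δ ∘ ρ_{α₀} : δ ∈ Δ}` (given the `Δ`-stability of every `α`) — the canonical, choice-free index set containing all the
saturated orbits. [claim: Mochizuki2012, status: disputed] (IUTchII §3 Prop 3.1 (i), kurims p.87) -/
theorem saturatedOrbit_subset_deltaClass_of_pair_of_pair [(PiYdd C).Normal] (hC : D.Compat) (hS : D.Sec2Hyps)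
    (h15 : D.Prop15iii E hC) (L : C.CuspLabels) (R : RigidData.{0} N l) (hR : R = C.rigidData μ hC hS h15 L)
    (h218i : R.Cor218_i) (α₁ : (Pi C) ≃ₜ* (Pi C))
    (hover₁ : ∀ x : Pi C, Env.recon.projG (Env.isoX (α₁ x)) = Env.recon.projG (Env.isoX x))
    (hsq₁ : ∃ δ₁ : Pi C, Env.recon.projG (Env.isoX δ₁) = 1 ∧ ∀ x : Pi C, α₁ (α₁ x) = δ₁ * x * δ₁⁻¹)
    (hαγ₁ : C.toLZ (α₁ γ) = Multiplicative.ofAdd (-1))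
    (hΔ : ∀ (α : (Pi C) ≃ₜ* (Pi C)) (x : Pi C),
      Env.recon.projG (Env.isoX (α x)) = 1 ↔ Env.recon.projG (Env.isoX x) = 1) :
    EtaleLevels.saturatedOrbit C hC hS h15 L hq μ R hR h218i α₁ ⊆
      {e | ∃ δ' : Pi C, Env.recon.projG (Env.isoX δ') = 1 ∧ ∀ x,
        e x = h1LimConj (phi C) (D.lDeltaTheta l) (PiYdd C) δ' (autActOfCor218i C hq μ hC hS h15 L R hR h218i α₀ x)} := by
  rintro e ⟨α, hα⟩
  obtain ⟨d, hd, h⟩ := exists_autActOfCor218i_eq_h1LimConj_of_pair_of_pair C Env α₀ γ hγ huniq hq μ hC hS h15 L R hR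
    h218i α₁ hover₁ hsq₁ hαγ₁
  obtain ⟨d', hd', h'⟩ := exists_autActOfCor218i_conj_eq_h1LimConj_of_pair C Env α₀ hover δ hδ hαα γ hγ hαγ huniq hq μ
    hC hS h15 L R hR h218i α (hΔ α)
  refine ⟨α d * d', by rw [map_mul, map_mul, (hΔ α d).mpr hd, hd', one_mul], fun x => ?_⟩
  rw [hα x, h, autActOfCor218i_conj, h', ← h1LimConj_mul_apply]

end OuterClass

end EtaleThetaDataOfSetting

end Literature.IUT.HodgeArakelov

end
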